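import Summits.QuantumFields.YangMills.Theses.HyperbolicRegulator

/-!
# Birth skeleton (BC3) for crux `HyperbolicToTorus` — stmt-QuantumFields-15827
(route `HyperbolicRegulator`, rank 4; sub-problem `YangMills`; published as
`Cruxes/HyperbolicToTorus/Lines/birth.lean`)

Registrar `planner-skel-stmt-QuantumFields-15827-0`, 2026-08-17 (skeleton-register one-shot; route re-audit bin
REPAIRABLE). Crux decl: `Summit.QuantumFields.YangMills.Theses.HyperbolicRegulator.HyperbolicToTorus` — for every
compact simple `G`, faithful unitary `r` and EVERY admissible hyperbolic family `(V, E, Q, σ, τ, bd, cV, cE)` (finite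
square complexes `S_(k,j)`, locally `ℤ²` off a `k`-net of degree-5 cones, Poincaré inequality at scale `k`, `ℤ²`-charts
of radius `k/4` at flat points; Wilson's `G`-theory in `r` on `S × S`): IF one rate `m(β) > 0` clusters all chart-read
gauge-invariant local observables for ALL curvature scales `k ≥ 8` at every `β ≥ β₁` (constants `C(β, k, A, B)`,
`j ≥ j₀`), THEN the `UniformLatticeGap` body holds for `r` (volume-uniform weak-coupling clustering of
`latticeConnectedCorr` on the tori `(2S+1)⁴`, `n ≤ S`). The route's own two-layer plan for this node is
`LocalLimitsAreWilsonGibbs → TorusIdentification`; this skeleton types exactly that seam, plus the one weakness the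
typing of the crux creates (its constants may depend on the curvature scale).

## Why this cut (three stubs)

The intended proof (route header): the deep flat balls of radius `k/4` carry Wilson–DLR conditional laws, so `k → ∞`
local limits of the family are flat Gibbs states of Wilson's specification on `ℤ⁴` at the same `β`, clustering at the
inherited rate; identify them with the periodic-torus states and transfer the clustering to `latticeConnectedCorr`
with `S`-uniform constants. Typed against the crux this has three genuinely different parts:

* `stub_uniformConstants` — **constants uniform in the curvature scale** (size M–L; the typed weakness). The crux's
  hypothesis gives, at `β ≥ β₁`, one rate `m(β)` but a FREE constant `C(β, k, A, B)` for every curvature scale `k`;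
  a local limit `k → ∞` at fixed separation inherits NOTHING from bounds whose constants may blow up with `k`. The stub
  upgrades (possibly at a larger threshold and a smaller rate) to ONE constant per pair `(A, B)` serving all `k ≥ 8`
  (`∃ C` before `∀ k`). Why it might fail: nothing in the hypotheses forces `sup_k C(β,k,A,B) < ∞`; a proof needs a
  covariance bootstrap for the finite-range reflection-positive Wilson field on the expander complex (Dobrushin–Shlosman
  / Martinelli–Olivieri type "weak mixing ⇒ strong mixing" upgrades are dimension- and geometry-sensitive) or the
  constants of `CurvatureUniformity` must be tracked — if neither is available this is the place where the tenure
  planner re-types `CurvatureUniformity` with `k`-uniform constants (then this stub is the identity). Sources: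
  DobrushinShlosman1987 (completely analytical interactions), MartinelliOlivieri1994, Seiler1982 Ch. 2.
* `stub_localGibbsLimit` — **local limits are flat Wilson–Gibbs states clustering at the inherited rate** (size L;
  `LocalLimitsAreWilsonGibbs`). At fixed `β` and rate `m > 0`, `k`-UNIFORM-constant clustering of an admissible family
  yields a DLR state `μ ∈ ymGibbsMeasures r.ρ β` of Wilson's specification on `ℤ⁴` whose connected correlations of
  gauge-invariant local observables decay at rate `m` in the sup norm, uniformly in the base point
  (`IsClusteringGibbsState`). Mechanism: read the law of the configuration in the product chart at a deep point
  `(x_k, x'_k)` of `S_(k,j(k)) × S_(k,j(k))` (a flat `ℤ⁴` box of radius `k/4`, all six plaquette orientations realised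
  by the three square sorts, ONE coupling `β`), extract a subsequential limit by compactness of `G^edges`
  (Riesz–Markov / Prokhorov, `G` compact metrisable from `IsCompactSimpleLieGroup`), check the DLR equations in every
  finite `Λ` from the finite-volume conditional laws inside the chart (finite range of `S_Λ`; Georgii Thm. 4.17 shape),
  and pass the clustering bound to the limit (graph distance inside a chart ≥ the `ℓ¹ ≥ ℓ^∞` chart distance for
  separations `< k/4`; charts at different flat base points differ by hypercubic motions, which permute `YMSpecies`).
  Why it might fail: chart transition maps are not axiomatised to be translations (only local graph isomorphisms),
  so base-point uniformity must come from the dihedral covariance of the species class; integrals are Bochner (bounded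
  measurable cylinder observables, fine). Sources: Georgii2011 Thm. 4.17 / Def. 2.9, Seiler1982 Ch. 2,
  arXiv:1803.01950 §2, OsterwalderSeiler1978 §4.
* `stub_torusIdentification` — **a clustering flat Gibbs state at weak coupling IS the torus theory, with
  volume-uniform constants** (size L/open; `TorusIdentification`). For `β ≥ β₂(G, r)`: if Wilson's specification at
  `β` admits a DLR state clustering exponentially at rate `m` (base-point uniformly), then the periodic states on
  `(2S+1)⁴` cluster in Euclidean time at some rate `m' > 0` with per-pair constants and a pair-uniform volume
  threshold `S₁`, for all `n ≤ S` (exactly the `UniformLatticeGap` clause at `β`). Two sub-steps (deliberately ONE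
  stub: the second is under-powered without the first): (a) identification — the torus states converge locally to `μ`
  (weak-coupling uniqueness among clustering states; reflection positivity + chessboard/transfer-matrix control of
  boundary influence), (b) transfer — vacuum dominance on the torus for `n ≤ S` (torelon sectors of mass
  `σ(β)(2S+1)`, wrap-around `e^{-m(2S+1-n)} ≤ e^{-m n}`), the 2001 ergodic-passage rows `W_fin⁰ ∧ (VD⁰) ⇒ gap`.
  Why it might fail (= the crux's): `ℤ⁴` Gibbs uniqueness at large `β` is open — several clustering phases would
  make the torus limit a non-clustering mixture (Ising-type obstruction; excluded only by belief for compact SIMPLE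
  `G`, false scenarios exist at bulk first-order points for some `G` at intermediate `β`, hence `β ≥ β₂`);
  `S`-uniform constants need Casimir/vacuum dominance, not just a gap. Sources: OsterwalderSeiler1978 §§2–4,
  Seiler1982 Ch. 2, arXiv:1803.01950 §5, arXiv:2006.16229, DobrushinShlosman1987.

Composition `HyperbolicToTorus_of : stub₁ → stub₂ → stub₃ → HyperbolicToTorus` (hypotheses spelled
`__Registered.stub_X`, name-keyed abbreviations of the stub statements, for the native audit — device of the
registered birth skeletons, e.g. `Cruxes/ContinuumFromLatticeGap/Lines/birth.lean`) is proved WITHOUT `sorry`: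
uniformise the constants (stub 1), take `β₀ := max β₁ β₂`, build the clustering flat Gibbs state at `(β, m(β))`
(stub 2) and identify it with the torus theory (stub 3). It concludes the route decl BY NAME. No stub is the crux
reworded: stub 1 lives entirely on the hyperbolic family (no torus), stub 2 produces an infinite-volume FLAT object
from the family (no torus), stub 3 never sees the family (flat DLR state ⇒ torus); none implies the crux or
`YangMills` on its own (BC3 probes below).

The hyperbolic-family vocabulary `Fam` / `Sp` below is, byte for byte, the `let Fam := …` / `let Sp := …` of the
three cruxes of the route file (rev 2, commit 923dcc990c10), made into named definitions so that the stub signatures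
stay short; the composition bridges named and inlined vocabulary by definitional unfolding only.

## Disproof used / negatives

None relevant for THIS crux: `ledger crux ls stmt-QuantumFields-15827` showed no workfiles (no `Disproof.lean`, no
landed `Theorems/HyperbolicToTorus/Negative/*`) on 2026-08-17, and the five entries of
`ledger negatives --problem QuantumFields` (RobustYangMillsRG, DiagonalMirrorRP, AdaptiveCoarseSystem,
MultibosonLatticeGap, AdmissibleRootsExist) are unrelated to the stubs. Degenerate audit: every stub keeps
`IsCompactSimpleLieGroup G` (so `G` is Hausdorff second countable and `ymSpecification r.ρ β` is a genuine
specification — `isSpecification_ymSpecification_t2`; for a non-`T₀` group `ymGibbsMeasures` could be junk-empty);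
`IsClusteringGibbsState` demands `μ ∈ ymGibbsMeasures` (hence a probability measure) AND a per-pair constant valid at
ALL base points and separations (at `v = 0` it forces `C ≥ |cov|`, so it is not vacuous and not unsatisfiable:
bounded observables); stub 3 carries its own threshold `β₂` (bulk first-order coexistence at intermediate `β` for some
`G` would otherwise refute it) and allows a smaller torus rate `m'`; stub 1 allows a larger threshold and a smaller
rate. Typing checklist 4c(ii): all integrands are bounded measurable cylinder functions under probability measures.

## BC3 audit (planner folder `bc/`, farm `lean check --json`, 2026-08-17)

This file: rc 0, errors [], sorries 3 = the three `stub_*` (the three `declaration uses sorry` warnings sit exactly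
on `stub_uniformConstants`, `stub_localGibbsLimit`, `stub_torusIdentification`), zero elsewhere;
`#print axioms HyperbolicToTorus_of` = [propext, Classical.choice, Quot.sound] (no `sorryAx`). Probes (stub
statements re-declared as sorry-free defs `S_<stub>` in `bc/probes_literal.lean` / `bc/probes_bcmd.lean`, nothing
sorried imported): for every stub `S ∈ {uniformConstants, localGibbsLimit, torusIdentification}` both
`S → HyperbolicToTorus` and `S → _root_.YangMills` FAIL — literal form `first | exact? | simpa | aesop`: 6/6
"unsolved goals" (each after `aesop: failed to prove the goal after exhaustive search`, i.e. `exact?` and `simpa`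
failed first); BC.md form `first | exact? | simpa [S] | (unfold S; simpa) | aesop` under `maxHeartbeats 400000`:
6/6 fail (stubs 1–2: deterministic heartbeat exhaustion in `whnf`/`isDefEq` of the unfolded family vocabulary;
stub 3: "unsolved goals" after exhaustive `aesop`). 12/12 probe examples fail: no stub is cheaply the crux or the
summit.
-/

noncomputable section

namespace Summit.QuantumFields.YangMills.Cruxes.HyperbolicToTorus.Birth

open scoped BigOperators Topology Manifold Classical MeasureTheory ProbabilityTheory Matrix InnerProductSpace ComplexConjugate ContinuousMap
open Filter Set Function TopologicalSpace MeasureTheory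
open Literature.MathematicalPhysics.QuantumFieldTheory Literature.MathematicalPhysics.QuantumLattice

/-! ## The route's hyperbolic-family vocabulary, named -/

section Vocabulary

variable (G : Type) [Group G] [TopologicalSpace G] [IsTopologicalGroup G] [CompactSpace G]
  [MeasurableSpace G] [BorelSpace G]

/-- **The hyperbolic-family vocabulary of route `HyperbolicRegulator`** — byte for byte the `let Fam := …` shared by
`CurvatureAnchor`, `CurvatureUniformity` and `HyperbolicToTorus`: for family data at curvature scale `k` and
separation index `j` (vertices `V`, oriented edges `E` with `σ`/`τ` = source/target, squares `Q` with oriented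
boundaries `bd`, vertex charts `cV`, edge charts `cE`) the PAIR (admissibility predicate, clustering predicate
`fun β m C A B => …` of Wilson's `G`-theory in `r` on the product complex `S × S`, chart-read observables at flat base
points, distance `dist(x,y) + dist(x',y')`). -/
def Fam (r : LatticeRep G) :=
  fun (k j : ℕ) (V E Q : Finset ℕ) (σ τ : ℕ → ℕ) (bd : ℕ → Fin 4 → ℕ × Bool) (cV : ℕ → ℤ × ℤ → ℕ) (cE : ℕ → ℤ × ℤ → Fin 2 → ℕ × Bool) => let st := fun e : ℕ × Bool => if e.2 then σ e.1 else τ e.1; let en := fun e : ℕ × Bool => if e.2 then τ e.1 else σ e.1; let Γ := SimpleGraph.fromRel fun a b : ℕ => ∃ e ∈ E, σ e = a ∧ τ e = b; let dg := fun x : ℕ => (E.filter fun e => σ e = x ∨ τ e = x).card; let K := V.filter fun x => dg x = 5; let F := fun x : ℕ => x ∈ V ∧ ∀ c ∈ K, k / 4 < Γ.dist x c; let Dp := fun x : ℕ => x ∈ V ∧ ∀ c ∈ K, k / 2 < Γ.dist x c; let ib := fun a : ℤ × ℤ => |a.1| ≤ (k : ℤ) / 4 ∧ |a.2| ≤ (k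 : ℤ) / 4; let nx := fun (a : ℤ × ℤ) (μ : Fin 2) => if μ = 0 then (a.1 + 1, a.2) else (a.1, a.2 + 1); let Ed := (ℕ × ℕ) ⊕ (ℕ × ℕ); let PE : Finset Ed := (E ×ˢ V).disjSum (V ×ˢ E); let Cfg := ↥PE → G; let ν := Measure.pi fun _ : ↥PE => haarProbability G; let v := fun (U : Cfg) (e : Ed × Bool) => if h : e.1 ∈ PE then (if e.2 then U ⟨e.1, h⟩ else (U ⟨e.1, h⟩)⁻¹) else 1; let w := fun (U : Cfg) (e : Fin 4 → Ed × Bool) => (r.ρ (v U (e 0) * v U (e 1) * v U (e 2) * v U (e 3))).trace.re; let S := fun U : Cfg => (∑ q ∈ Q, ∑ y ∈ V, w U fun i => (Sum.inl ((bd q i).1, y), (bd q i).2)) + (∑ y ∈ V, ∑ q ∈ Q, w U fun i => (Sum.inr (y, (bd q i).1), (bd q i).2)) + ∑ e ∈ E, ∑ e' ∈ E, w U ![(Sum.inl (e, σ e'), true), (Sum.inr (τ e, e'), true), (Sum.inl (e, τ e'), false), (Sum.inr (σ e, e'), false)]; let d0 : Fin 4 → Fin 2 := ![0, 1, 0, 1];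 let P := fun (x x' : ℕ) (U : Cfg) (p : ZdEdge 4) => let a := (p.1 0, p.1 1); let b := (p.1 2, p.1 3); if p.2 = 0 ∨ p.2 = 1 then v U (Sum.inl ((cE x a (d0 p.2)).1, cV x' b), (cE x a (d0 p.2)).2) else v U (Sum.inr (cV x a, (cE x' b (d0 p.2)).1), (cE x' b (d0 p.2)).2); ((∀ e ∈ E, σ e ∈ V ∧ τ e ∈ V ∧ σ e ≠ τ e) ∧ (∀ q ∈ Q, (∀ i, (bd q i).1 ∈ E) ∧ (∀ i, en (bd q i) = st (bd q (i + 1))) ∧ (st ∘ bd q).Injective) ∧ (∀ e ∈ E, (Q.filter fun q => ∃ i, (bd q i).1 = e).card = 2) ∧ (∀ x ∈ V, (dg x = 4 ∨ dg x = 5) ∧ (Q.filter fun q => ∃ i, st (bd q i) = x).card = dg x) ∧ (∀ x ∈ V, ∃ c ∈ K, Γ.dist x c ≤ k) ∧ (∀ c ∈ K, ∀ c' ∈ K, c ≠ c' → k ≤ Γ.dist c c') ∧ (∀ f : ℕ → ℝ, ∑ x ∈ V, f x = 0 → ∑ x ∈ V, f x ^ 2 ≤ 10 ^ 6 * (k :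 ℝ) ^ 2 * ∑ e ∈ E, (f (σ e) - f (τ e)) ^ 2) ∧ (∃ x y, Dp x ∧ Dp y ∧ j ≤ Γ.dist x y) ∧ (∀ x, F x → cV x (0, 0) = x ∧ (∀ a, ib a → cV x a ∈ V) ∧ Set.InjOn (cV x) {a | ib a} ∧ (∀ a μ, ib a → ib (nx a μ) → (cE x a μ).1 ∈ E ∧ st (cE x a μ) = cV x a ∧ en (cE x a μ) = cV x (nx a μ)) ∧ (∀ a, ib a → ib (a.1 + 1, a.2 + 1) → ∃ q ∈ Q, Finset.univ.image (Prod.fst ∘ bd q) = {(cE x a 0).1, (cE x (nx a 0) 1).1, (cE x (nx a 1) 0).1, (cE x a 1).1})), fun (β m C : ℝ) (A B : YMSpecies G) => let X := fun f : Cfg → ℝ => (∫ U, f U * Real.exp (β * S U) ∂ν) / (∫ U, Real.exp (β * S U) ∂ν); ∀ x x' y y', F x → F x' → F y → F y' → |X (fun U => A.F (P x x' U) * B.F (P y y' U)) - X (fun U => A.F (P x x' U)) * X (fun U => B.F (P y y' U))| ≤ C * Real.exp (-(m * ((Γ.dist x y + Γ.dist x' y' : ℕ) : ℝ))))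

variable {G} in
/-- **Support radius** — byte for byte the route's `let Sp := …`: every edge in the support of the gauge-invariant
local observable `A` has base point in the sup-norm ball of radius `R`. -/
def Sp : YMSpecies G → ℕ → Prop :=
  fun (A : YMSpecies G) (R : ℕ) => ∀ p ∈ A.supp, ∀ i, |p.1 i| ≤ (R : ℤ)

/-- **A flat Wilson–Gibbs state clustering at rate `m`, uniformly in the base point**: `μ` is a DLR state of the
lattice Yang–Mills (Wilson) specification of `r` at inverse coupling `β` on `ℤ⁴` (`ymGibbsMeasures`, hence a
probability measure) and for every pair of gauge-invariant local observables `A, B` ONE constant `C(A, B)` bounds the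
connected correlation of the translates `A ∘ θ_x`, `B ∘ θ_{x+v}` by `C e^{-m ‖v‖_∞}` for ALL base points `x` and
separations `v` (sup norm on `ℤ⁴`, as in `HasExponentialDecayRate`). The meeting point of the local-limit step and
the torus-identification step. -/
def IsClusteringGibbsState (r : LatticeRep G) (β m : ℝ) (μ : Measure (LGConfig 4 G)) : Prop :=
  μ ∈ ymGibbsMeasures (d := 4) r.ρ β ∧
    ∀ A B : YMSpecies G, ∃ C : ℝ, ∀ x v : Literature.Probability.LatticeModels.Site 4,
      |(∫ U, A.F (configShift x U) * B.F (configShift (x + v) U) ∂μ) -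
          (∫ U, A.F (configShift x U) ∂μ) * ∫ U, B.F (configShift (x + v) U) ∂μ| ≤
        C * Real.exp (-(m * ‖v‖))

end Vocabulary

/-! ## Registered stubs -/

/-- **Stub 1 — constants uniform in the curvature scale.** For every compact simple `G`, faithful unitary `r` and
admissible hyperbolic family: the crux's hypothesis (one rate `m(β)` for all `k ≥ 8` at every `β ≥ β₁`, constants
FREE in `k`) upgrades to clustering with ONE constant per pair of observables serving every curvature scale `k ≥ 8`
(threshold and rate may change). The typed weakness of the node: without it a local limit `k → ∞` inherits nothing.
Size M–L (covariance bootstrap for a finite-range RP field on the expander complex, or constants tracked through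
`CurvatureUniformity`). -/
theorem stub_uniformConstants :
    ∀ (G : Type) [Group G] [TopologicalSpace G] [IsTopologicalGroup G] [CompactSpace G],
    IsCompactSimpleLieGroup G →
    letI : MeasurableSpace G := borel G
    haveI : BorelSpace G := ⟨rfl⟩
    ∀ (r : LatticeRep G) (V E Q : ℕ → ℕ → Finset ℕ) (σ τ : ℕ → ℕ → ℕ → ℕ)
    (bd : ℕ → ℕ → ℕ → Fin 4 → ℕ × Bool) (cV : ℕ → ℕ → ℕ → ℤ × ℤ → ℕ)
    (cE : ℕ → ℕ → ℕ → ℤ × ℤ → Fin 2 → ℕ × Bool),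
    (∀ k j, 8 ≤ k → (Fam G r k j (V k j) (E k j) (Q k j) (σ k j) (τ k j) (bd k j) (cV k j) (cE k j)).1) →
    (∃ β₁ : ℝ, ∀ β, β₁ ≤ β → ∃ m : ℝ, 0 < m ∧ ∀ k, 8 ≤ k → ∀ A B : YMSpecies G,
    Sp A (k / 8) → Sp B (k / 8) → ∃ C j₀, ∀ j, j₀ ≤ j → (Fam G r k j (V k j) (E k j) (Q k j) (σ k j) (τ k j) (bd k j) (cV k j) (cE k j)).2 β m C A B) →
    ∃ β₁ : ℝ, ∀ β, β₁ ≤ β → ∃ m : ℝ, 0 < m ∧ ∀ A B : YMSpecies G, ∃ C : ℝ, ∀ k, 8 ≤ k →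
    Sp A (k / 8) → Sp B (k / 8) → ∃ j₀ : ℕ, ∀ j, j₀ ≤ j → (Fam G r k j (V k j) (E k j) (Q k j) (σ k j) (τ k j) (bd k j) (cV k j) (cE k j)).2 β m C A B := by
  sorry

/-- **Stub 2 — local limits are flat Wilson–Gibbs states clustering at the inherited rate**
(`LocalLimitsAreWilsonGibbs`). For every compact simple `G`, faithful unitary `r`, admissible hyperbolic family,
coupling `β` and rate `m > 0`: `k`-uniform-constant clustering of the family at `(β, m)` yields a DLR state of
Wilson's specification on `ℤ⁴` at `β` clustering at rate `m` uniformly in the base point (`IsClusteringGibbsState`)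
— product-chart laws at deep points, compactness of `G^edges`, DLR inside the charts, clustering passed to the limit.
Size L. -/
theorem stub_localGibbsLimit :
    ∀ (G : Type) [Group G] [TopologicalSpace G] [IsTopologicalGroup G] [CompactSpace G],
    IsCompactSimpleLieGroup G →
    letI : MeasurableSpace G := borel G
    haveI : BorelSpace G := ⟨rfl⟩
    ∀ (r : LatticeRep G) (V E Q : ℕ → ℕ → Finset ℕ) (σ τ : ℕ → ℕ → ℕ → ℕ)
    (bd : ℕ → ℕ → ℕ → Fin 4 → ℕ × Bool) (cV : ℕ → ℕ → ℕ → ℤ × ℤ → ℕ)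
    (cE : ℕ → ℕ → ℕ → ℤ × ℤ → Fin 2 → ℕ × Bool),
    (∀ k j, 8 ≤ k → (Fam G r k j (V k j) (E k j) (Q k j) (σ k j) (τ k j) (bd k j) (cV k j) (cE k j)).1) →
    ∀ (β m : ℝ), 0 < m →
    (∀ A B : YMSpecies G, ∃ C : ℝ, ∀ k, 8 ≤ k →
    Sp A (k / 8) → Sp B (k / 8) → ∃ j₀ : ℕ, ∀ j, j₀ ≤ j → (Fam G r k j (V k j) (E k j) (Q k j) (σ k j) (τ k j) (bd k j) (cV k j) (cE k j)).2 β m C A B) →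
    ∃ μ : Measure (LGConfig 4 G), IsClusteringGibbsState G r β m μ := by
  sorry

/-- **Stub 3 — torus identification with volume-uniform constants** (`TorusIdentification`). For every compact
simple `G` and faithful unitary `r` there is `β₂` such that for `β ≥ β₂`: if Wilson's specification at `β` admits a
DLR state on `ℤ⁴` clustering exponentially (base-point uniformly) at some rate `m > 0`, then the periodic Wilson
states on the tori `(2S+1)⁴` cluster in Euclidean time at some rate `m' > 0` with per-pair constants and a
pair-uniform volume threshold, for all `n ≤ S` — the `UniformLatticeGap` clause at `β`. Identification (weak-coupling
uniqueness among clustering states) + vacuum dominance on the torus; size L / open. -/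
theorem stub_torusIdentification :
    ∀ (G : Type) [Group G] [TopologicalSpace G] [IsTopologicalGroup G] [CompactSpace G],
    IsCompactSimpleLieGroup G →
    letI : MeasurableSpace G := borel G
    haveI : BorelSpace G := ⟨rfl⟩
    ∀ (r : LatticeRep G), ∃ β₂ : ℝ, ∀ β, β₂ ≤ β →
    ∀ (m : ℝ) (μ : Measure (LGConfig 4 G)), 0 < m → IsClusteringGibbsState G r β m μ →
    ∃ m' : ℝ, 0 < m' ∧ ∃ S₁ : ℕ, ∀ A B : YMSpecies G, ∃ C : ℝ, ∀ S n, S₁ ≤ S → n ≤ S →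
    |latticeConnectedCorr r.ρ β (2 * S + 1) A.F B.F n| ≤ C * Real.exp (-(m' * n)) := by
  sorry

/-! ## Name-keyed aliases of the stub statements (hypotheses of `HyperbolicToTorus_of`)

The native skeleton audit (`#h21_check_skeleton`) admits a hypothesis of the skeleton theorem only if its head
constant is a registered obligation or is NAMED like a declared stub; `__Registered.stub_X` is the statement of
`stub_X` under that name (device of the registered birth skeletons). Each alias is syntactically the statement of its
stub; the final `example` checks that the sorried stubs instantiate them. -/
namespace __Registered

/-- Statement of `stub_uniformConstants`, keyed by the stub name. -/
abbrev stub_uniformConstants : Prop :=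
  ∀ (G : Type) [Group G] [TopologicalSpace G] [IsTopologicalGroup G] [CompactSpace G],
  IsCompactSimpleLieGroup G →
  letI : MeasurableSpace G := borel G
  haveI : BorelSpace G := ⟨rfl⟩
  ∀ (r : LatticeRep G) (V E Q : ℕ → ℕ → Finset ℕ) (σ τ : ℕ → ℕ → ℕ → ℕ)
  (bd : ℕ → ℕ → ℕ → Fin 4 → ℕ × Bool) (cV : ℕ → ℕ → ℕ → ℤ × ℤ → ℕ)
  (cE : ℕ → ℕ → ℕ → ℤ × ℤ → Fin 2 → ℕ × Bool),
  (∀ k j, 8 ≤ k → (Fam G r k j (V k j) (E k j) (Q k j) (σ k j) (τ k j) (bd k j) (cV k j) (cE k j)).1) →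
  (∃ β₁ : ℝ, ∀ β, β₁ ≤ β → ∃ m : ℝ, 0 < m ∧ ∀ k, 8 ≤ k → ∀ A B : YMSpecies G,
  Sp A (k / 8) → Sp B (k / 8) → ∃ C j₀, ∀ j, j₀ ≤ j → (Fam G r k j (V k j) (E k j) (Q k j) (σ k j) (τ k j) (bd k j) (cV k j) (cE k j)).2 β m C A B) →
  ∃ β₁ : ℝ, ∀ β, β₁ ≤ β → ∃ m : ℝ, 0 < m ∧ ∀ A B : YMSpecies G, ∃ C : ℝ, ∀ k, 8 ≤ k →
  Sp A (k / 8) → Sp B (k / 8) → ∃ j₀ : ℕ, ∀ j, j₀ ≤ j → (Fam G r k j (V k j) (E k j) (Q k j) (σ k j) (τ k j) (bd k j) (cV k j) (cE k j)).2 β m C A B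

/-- Statement of `stub_localGibbsLimit`, keyed by the stub name. -/
abbrev stub_localGibbsLimit : Prop :=
  ∀ (G : Type) [Group G] [TopologicalSpace G] [IsTopologicalGroup G] [CompactSpace G],
  IsCompactSimpleLieGroup G →
  letI : MeasurableSpace G := borel G
  haveI : BorelSpace G := ⟨rfl⟩
  ∀ (r : LatticeRep G) (V E Q : ℕ → ℕ → Finset ℕ) (σ τ : ℕ → ℕ → ℕ → ℕ)
  (bd : ℕ → ℕ → ℕ → Fin 4 → ℕ × Bool) (cV : ℕ → ℕ → ℕ → ℤ × ℤ → ℕ)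
  (cE : ℕ → ℕ → ℕ → ℤ × ℤ → Fin 2 → ℕ × Bool),
  (∀ k j, 8 ≤ k → (Fam G r k j (V k j) (E k j) (Q k j) (σ k j) (τ k j) (bd k j) (cV k j) (cE k j)).1) →
  ∀ (β m : ℝ), 0 < m →
  (∀ A B : YMSpecies G, ∃ C : ℝ, ∀ k, 8 ≤ k →
  Sp A (k / 8) → Sp B (k / 8) → ∃ j₀ : ℕ, ∀ j, j₀ ≤ j → (Fam G r k j (V k j) (E k j) (Q k j) (σ k j) (τ k j) (bd k j) (cV k j) (cE k j)).2 β m C A B) →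
  ∃ μ : Measure (LGConfig 4 G), IsClusteringGibbsState G r β m μ

/-- Statement of `stub_torusIdentification`, keyed by the stub name. -/
abbrev stub_torusIdentification : Prop :=
  ∀ (G : Type) [Group G] [TopologicalSpace G] [IsTopologicalGroup G] [CompactSpace G],
  IsCompactSimpleLieGroup G →
  letI : MeasurableSpace G := borel G
  haveI : BorelSpace G := ⟨rfl⟩
  ∀ (r : LatticeRep G), ∃ β₂ : ℝ, ∀ β, β₂ ≤ β →
  ∀ (m : ℝ) (μ : Measure (LGConfig 4 G)), 0 < m → IsClusteringGibbsState G r β m μ →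
  ∃ m' : ℝ, 0 < m' ∧ ∃ S₁ : ℕ, ∀ A B : YMSpecies G, ∃ C : ℝ, ∀ S n, S₁ ≤ S → n ≤ S →
  |latticeConnectedCorr r.ρ β (2 * S + 1) A.F B.F n| ≤ C * Real.exp (-(m' * n))

end __Registered

/-! ## Composition: the crux BY NAME from the three stub statements (no `sorry` below) -/

/-- **`HyperbolicToTorus_of`** — uniformise the constants in the curvature scale (Stub 1), take the threshold
`β₀ := max β₁ β₂`, build at each `β ≥ β₀` the flat Wilson–Gibbs state clustering at the family's rate `m(β)`
(Stub 2), and identify it with the torus theory with volume-uniform constants (Stub 3). Hypotheses = the three stub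
statements under their registered names; conclusion = the route decl, by name. The named vocabulary `Fam`/`Sp` and
the crux's inlined `let Fam`/`let Sp` agree by definitional unfolding. -/
theorem HyperbolicToTorus_of (h₁ : __Registered.stub_uniformConstants)
    (h₂ : __Registered.stub_localGibbsLimit) (h₃ : __Registered.stub_torusIdentification) :
    Summit.QuantumFields.YangMills.Theses.HyperbolicRegulator.HyperbolicToTorus := by
  intro G _ _ _ _ hG r Fam₀ Sp₀ V E Q σ τ bd cV cE Φ hAdm hClust
  -- Step 1: constants uniform in the curvature scale.
  obtain ⟨β₁, hU⟩ := h₁ G hG r V E Q σ τ bd cV cE hAdm hClust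
  -- Step 3 (threshold): torus identification is available beyond `β₂`.
  obtain ⟨β₂, hT⟩ := h₃ G hG r
  refine ⟨max β₁ β₂, fun β hβ => ?_⟩
  obtain ⟨m, hm, hC⟩ := hU β ((le_max_left _ _).trans hβ)
  -- Step 2: the clustering flat Wilson–Gibbs state at `(β, m)`.
  obtain ⟨μ, hμ⟩ := h₂ G hG r V E Q σ τ bd cV cE hAdm β m hm hC
  -- Step 3: identify it with the torus theory.
  exact hT β ((le_max_right _ _).trans hβ) m μ hm hμ

/-- Signature match: the registered stubs instantiate the hypotheses of the composition (kernel-checked; this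
`example` is the only place the sorried stubs are consumed). -/
example : Summit.QuantumFields.YangMills.Theses.HyperbolicRegulator.HyperbolicToTorus :=
  HyperbolicToTorus_of stub_uniformConstants stub_localGibbsLimit stub_torusIdentification

end Summit.QuantumFields.YangMills.Cruxes.HyperbolicToTorus.Birth

end
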